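import Summits.FinalStateConjecture.FinalStateConjecture.Theses.EIHFluxBalance
import Summits.FinalStateConjecture.FinalStateConjecture.Theorems.EIHFluxBalanceLLBalanceLawIdentities
import Summits.FinalStateConjecture.FinalStateConjecture.Theorems.EIHFluxBalanceLLBalanceLawSphere
import Summits.FinalStateConjecture.FinalStateConjecture.Theorems.EIHFluxBalanceLLBalanceLawMomentum

/-!
# Route EIHFluxBalance — `LLBalanceLaw` (item `stmt-FinalStateConjecture-10189`): the closing theorem

`LLBalanceLaw_proof : Theses.EIHFluxBalance.LLBalanceLaw` assembles the five conjuncts of the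
Landau–Lifshitz balance law over `Literature.Geometry.Lorentzian.LandauLifshitzPseudotensor`:
the three pointwise identities (i)–(iii) (`LLBalance.llBalanceLaw_pointwise`,
file `EIHFluxBalanceLLBalanceLawIdentities`), the balance law (iv) `dP^μ/dt = −Φ^μ` on a
coordinate sphere surrounded by vacuum (`LLBalance.hasDerivAt_quasiLocalMomentum`,
file `EIHFluxBalanceLLBalanceLawMomentum`) and the radius-averaging formula (v)
(`LLBalance.shellAverage`, file `EIHFluxBalanceLLBalanceLawSphere`).
Sources: Landau–Lifshitz, *The Classical Theory of Fields* §96 (key `LandauLifshitz1975`);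
Blanchet, Living Rev. Relativ., arXiv:1310.1528, §2.
-/

noncomputable section

namespace Summit.FinalStateConjecture.FinalStateConjecture.Theorems

open Literature.Geometry.Lorentzian Literature.Geometry.Lorentzian.LandauLifshitz in
/-- **`LLBalanceLaw` (item `stmt-FinalStateConjecture-10189` of route `EIHFluxBalance`) holds**:
for a `C^∞` field of symmetric bilinear forms `g` with `det (g_{μν}) < 0` on an open `U ⊆ E4`,
(i) `Σ_α ∂_α h^{μνα} = (−g)((8π)⁻¹ G^{μν} + t^{μν}_LL)` (definition (96.7) of the pseudotensor),
(ii) `Σ_ν ∂_ν [(−g)((8π)⁻¹G^{μν} + t^{μν})] = 0` identically and (iii) `Σ_ν ∂_ν [(−g) t^{μν}] = 0`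
in vacuum (`LLBalance.llBalanceLaw_pointwise`), (iv) the balance law
`dP^μ/dt = −∮ (−g) t^{μk}_LL n_k dσ` for the quasi-local momentum of a coordinate sphere
surrounded by vacuum (`LLBalance.hasDerivAt_quasiLocalMomentum`), and (v) the radius-averaging
formula `∫_R^{2R} ∮_{S_ρ} f dσ dρ = ∫_{R<|y−ξ|<2R} f` (`LLBalance.shellAverage`). Landau–Lifshitz,
*The Classical Theory of Fields* §96; Blanchet, arXiv:1310.1528, §2. The symmetry hypothesis is
not needed. [cite: LandauLifshitz1975, §96 (96.7)–(96.16)] -/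
theorem LLBalanceLaw_proof :
    Summit.FinalStateConjecture.FinalStateConjecture.Theses.EIHFluxBalance.LLBalanceLaw := by
  unfold Theses.EIHFluxBalance.LLBalanceLaw
  intro g U hU hg _ hdet
  have hdet' : ∀ x ∈ U, metricDet g x ≠ 0 := fun x hx ↦ (hdet x hx).ne
  obtain ⟨h1, h2, h3⟩ := LLBalance.llBalanceLaw_pointwise g U hU hg hdet
  refine ⟨h1, h2, h3, fun t R ξ _ hS hric μ ↦ ?_, fun f ξ R hR hf ↦ ?_⟩
  · exact LLBalance.hasDerivAt_quasiLocalMomentum hU hg hdet' hric hS μ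
  · exact LLBalance.shellAverage f ξ R hR hf

end Summit.FinalStateConjecture.FinalStateConjecture.Theorems

end
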